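import Summits.CriticalPhenomena.PercolationContinuityZ3.Theorems.PercNearOneGluingNoHeavyQuantConvAtomsAssembly
import Summits.CriticalPhenomena.PercolationContinuityZ3.Theorems.PercNearOneGluingNoHeavyQuantGateMove
import HarnessLib

/-!
# QUANT lane R8: the tree row from the TWO statements of record — (II) `LawDec.LightSliceCore` (census-2 g58, README V295) and either leg-(III)
# statement, `LawDec.GatedConvEmptyFree` (typer g25) OR `LawDec.GateMove` (typer g26) — the 2 × 2 bridge table, so whichever lands first closes R8 on trees

builds on p205010 (kernel theorem, internal audit signed; external expert review pending)

Support file (`--supports stmt-CriticalPhenomena-4575`), QUANT lane lead (gen 27), rung R8 of `run/shared/lean/prim/quant/LADDER.md`.  Theorems only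
(one-line compositions), standard axioms, no sorries.  `farTreeRow_of_lightSliceCore` (E-route) is census-2 g58's (`…QuantConvAtomsAssembly`); this file adds
the GM′-route `LightSliceCore → GateMove → SDECConvClosed / TreeBuiltDEC / TreeDEC / FarTreeRow` (via `convClosedT_of_lightSliceCore` and typer g26's
`sdecConvClosed_of_convClosedT_of_gateMove`).  HONEST STATUS: `LightSliceCore`, `GateMove`, `GatedConvEmptyFree`, hence `ConvClosedT`, `SDECConvClosed`,
`TreeBuiltDEC`, `TreeDEC`, `FarTreeRow` are all OPEN; these are CONDITIONAL results.

[this work]; (II): census-2 g56–g58, census-1 g20–g22, lead g22/g26; (III): typer g25–g26 (this lane).  Nothing here is cited as a published result.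
The gluing rows served [cite: KozmaNitzan2024, Conjecture 3 (p. 15)]; product measure [cite: Grimmett1999, §1.3 p. 10].
-/

noncomputable section

namespace Summit.CriticalPhenomena.PercolationContinuityZ3.Theorems

namespace Quant

namespace LawDec

/-- **`LightSliceCore` ∧ `GateMove` ⟹ `SDECConvClosed`** (the GM′ route). [this work] -/
theorem sdecConvClosed_of_lightSliceCore_gateMove (hL : LightSliceCore) (hG : GateMove) : SDECConvClosed :=
  sdecConvClosed_of_convClosedT_of_gateMove (convClosedT_of_lightSliceCore hL) hG

/-- **`LightSliceCore` ∧ `GateMove` ⟹ `TreeBuiltDEC`**. [this work] -/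
theorem treeBuiltDEC_of_lightSliceCore_gateMove (hL : LightSliceCore) (hG : GateMove) : TreeBuiltDEC :=
  treeBuiltDEC_of_sdecConvClosed (sdecConvClosed_of_lightSliceCore_gateMove hL hG)

end LawDec

/-- **`LightSliceCore` ∧ `GateMove` ⟹ `Quant.TreeDEC`**. [this work] -/
theorem treeDEC_of_lightSliceCore_gateMove (hL : LawDec.LightSliceCore) (hG : LawDec.GateMove) : TreeDEC :=
  treeDEC_of_sdecConvClosed (LawDec.sdecConvClosed_of_lightSliceCore_gateMove hL hG)

/-- **`LightSliceCore` ∧ `GateMove` ⟹ `Quant.FarTreeRow`** — FAR on trees from the light-slice inequality family and the gate move.  CONDITIONAL: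
both hypotheses are `@[conjecture]`s. [this work] -/
theorem farTreeRow_of_lightSliceCore_gateMove (hL : LawDec.LightSliceCore) (hG : LawDec.GateMove) : FarTreeRow :=
  farTreeRow_of_sdecConvClosed (LawDec.sdecConvClosed_of_lightSliceCore_gateMove hL hG)

end Quant

end Summit.CriticalPhenomena.PercolationContinuityZ3.Theorems
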